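import Summits.CriticalPhenomena.PercolationContinuityZ3.Theses.PercGamblersRuin

/-!
# Route `PercGamblersRuin`, support item `MinimalVoltage` (stmt-CriticalPhenomena-7774)

For all `a < b` and `n > 0` there is a selection `v : Ω → ℤ³ → ℝ` of slab voltages — for EVERY bond
configuration `ω`: `0 ≤ v ≤ 1`, `v = 1` on the ceiling region `{x₀ ≥ bn}`, `v = 0` on the floor region
`{x₀ ≤ -an}`, and harmonic for the open lattice edges at every interior vertex `-an < x₀ < bn` — with
`ω ↦ v(ω, 0)` measurable and GROUNDED: `v(ω, 0) ≠ 0` only if `0` is joined to the ceiling `{x₀ = bn}` by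
an open path inside `{x₀ > -an}`.

Proof (Lyons–Peres, *Probability on Trees and Networks* (2016), §2.1, existence for the Dirichlet
problem by monotone iteration; Grimmett, *Percolation* (1999), §1.3 for the percolation vocabulary): the
MINIMAL voltage. Fix `ω` and let `T` be the averaging operator
`T f x = 1` if `x₀ ≥ B`, `= 0` if `x₀ ≤ -A`, and otherwise the mean of `f` over the open neighbours of `x`
(`= 0` if there are none, by `0 / 0 = 0`). Starting from `f₀ = 1_{x₀ ≥ B}` the iterates `T^[k] f₀` are
`[0, 1]`-valued and increase in `k` (`T` is monotone and `f₀ ≤ T f₀`), so they converge to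
`v = ⨆ k, T^[k] f₀`; as every sum is finite, `v = T v`, which is the plate conditions plus harmonicity.
Each `ω ↦ (T_ω^[k] f₀) x` is measurable (induction on `k`: finite sums of indicator-weighted measurable
functions), hence so is the countable supremum. Groundedness: `(T^[k] f₀) x ≠ 0` with `x₀ ≤ B` forces an
open path of length `≤ k` from `x` to the plane `{x₀ = B}` inside `{x₀ > -A}` (induction on `k`: a
non-zero mean has a non-zero term at an open neighbour, one level up at most).

Design: NO new definitions — the operator `T` enters the helper lemmas as a hypothesis `hT` giving its
formula, the iterates are Mathlib's `Nat.iterate`, and the voltage is the `iSup` of the iterates; the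
deciding theorem `MinimalVoltage_proof` instantiates `T` by a lambda. The abstract part (any vertex type,
any finite neighbourhoods `N x`, any plate predicates `p`, `q`) is separated from the lattice part
(measurability in `ω`, groundedness, heights of lattice neighbours).
-/

noncomputable section

namespace Summit.CriticalPhenomena.PercolationContinuityZ3.Theorems

open MeasureTheory Filter Topology
open Literature.Probability.Percolation Literature.Probability.LatticeModels
open scoped Classical

namespace SlabVoltage

/-! ### The abstract averaging iteration -/

section Abstract

variable {V : Type*} {N : V → Finset V} {p q : V → Prop} [DecidablePred p] [DecidablePred q]
  {T : (V → ℝ) → V → ℝ}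

/-- The averaging operator is monotone. [folklore] -/
theorem step_mono
    (hT : ∀ f x, T f x = if p x then 1 else if q x then 0 else (∑ y ∈ N x, f y) / ((N x).card : ℝ))
    {f g : V → ℝ} (hfg : ∀ x, f x ≤ g x) (x : V) : T f x ≤ T g x := by
  rw [hT, hT]
  split_ifs
  · exact le_rfl
  · exact le_rfl
  · exact div_le_div_of_nonneg_right (Finset.sum_le_sum fun y _ => hfg y) (Nat.cast_nonneg _)

/-- The averaging operator preserves `[0, 1]`-valued functions. [folklore] -/
theorem step_mem_Icc
    (hT : ∀ f x, T f x = if p x then 1 else if q x then 0 else (∑ y ∈ N x, f y) / ((N x).card : ℝ))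
    {f : V → ℝ} (hf : ∀ x, f x ∈ Set.Icc (0 : ℝ) 1) (x : V) : T f x ∈ Set.Icc (0 : ℝ) 1 := by
  rw [hT]
  split_ifs
  · exact ⟨zero_le_one, le_rfl⟩
  · exact ⟨le_rfl, zero_le_one⟩
  · refine ⟨div_nonneg (Finset.sum_nonneg fun y _ => (hf y).1) (Nat.cast_nonneg _), ?_⟩
    refine div_le_one_of_le₀ ?_ (Nat.cast_nonneg _)
    calc ∑ y ∈ N x, f y ≤ ∑ _y ∈ N x, (1 : ℝ) := Finset.sum_le_sum fun y _ => (hf y).2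
      _ = ((N x).card : ℝ) := by rw [Finset.sum_const, nsmul_eq_mul, mul_one]

/-- The iterates `T^[k] 1_{p}` are `[0, 1]`-valued. [folklore] -/
theorem iterate_mem_Icc
    (hT : ∀ f x, T f x = if p x then 1 else if q x then 0 else (∑ y ∈ N x, f y) / ((N x).card : ℝ))
    (k : ℕ) (x : V) : (T^[k] fun z => if p z then (1 : ℝ) else 0) x ∈ Set.Icc (0 : ℝ) 1 := by
  induction k generalizing x with
  | zero =>
    simp only [Function.iterate_zero, id_eq]
    split_ifs
    · exact ⟨zero_le_one, le_rfl⟩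
    · exact ⟨le_rfl, zero_le_one⟩
  | succ k ih =>
    rw [Function.iterate_succ_apply']
    exact step_mem_Icc hT ih x

/-- The iterates `T^[k] 1_{p}` increase in `k` (`1_{p} ≤ T 1_{p}` and `T` is monotone). [folklore] -/
theorem iterate_le_succ
    (hT : ∀ f x, T f x = if p x then 1 else if q x then 0 else (∑ y ∈ N x, f y) / ((N x).card : ℝ))
    (k : ℕ) (x : V) :
    (T^[k] fun z => if p z then (1 : ℝ) else 0) x ≤ (T^[k + 1] fun z => if p z then (1 : ℝ) else 0) x := by
  induction k generalizing x with
  | zero =>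
    rw [Function.iterate_succ_apply', Function.iterate_zero, id_eq, hT]
    split_ifs
    · exact le_rfl
    · exact le_rfl
    · exact div_nonneg (Finset.sum_nonneg fun y _ => by split_ifs <;> norm_num) (Nat.cast_nonneg _)
  | succ k ih =>
    rw [Function.iterate_succ_apply', Function.iterate_succ_apply' (n := k + 1)]
    exact step_mono hT ih x

/-- The iterates converge to their supremum `v x = ⨆ k, (T^[k] 1_{p}) x`. [folklore] -/
theorem tendsto_iterate
    (hT : ∀ f x, T f x = if p x then 1 else if q x then 0 else (∑ y ∈ N x, f y) / ((N x).card : ℝ))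
    (x : V) :
    Tendsto (fun k => (T^[k] fun z => if p z then (1 : ℝ) else 0) x) atTop
      (𝓝 (⨆ k, (T^[k] fun z => if p z then (1 : ℝ) else 0) x)) :=
  tendsto_atTop_ciSup (monotone_nat_of_le_succ fun k => iterate_le_succ hT k x)
    ⟨1, by rintro _ ⟨k, rfl⟩; exact (iterate_mem_Icc hT k x).2⟩

/-- The limit voltage is `[0, 1]`-valued. [folklore] -/
theorem iSup_iterate_mem_Icc
    (hT : ∀ f x, T f x = if p x then 1 else if q x then 0 else (∑ y ∈ N x, f y) / ((N x).card : ℝ))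
    (x : V) : (⨆ k, (T^[k] fun z => if p z then (1 : ℝ) else 0) x) ∈ Set.Icc (0 : ℝ) 1 := by
  have hbdd : BddAbove (Set.range fun k => (T^[k] fun z => if p z then (1 : ℝ) else 0) x) :=
    ⟨1, by rintro _ ⟨k, rfl⟩; exact (iterate_mem_Icc hT k x).2⟩
  exact ⟨(iterate_mem_Icc hT 0 x).1.trans (le_ciSup hbdd 0), ciSup_le fun k => (iterate_mem_Icc hT k x).2⟩

/-- On the first plate (`p x`) every iterate equals `1`. [folklore] -/
theorem iterate_eq_one
    (hT : ∀ f x, T f x = if p x then 1 else if q x then 0 else (∑ y ∈ N x, f y) / ((N x).card : ℝ))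
    {x : V} (hx : p x) (k : ℕ) : (T^[k] fun z => if p z then (1 : ℝ) else 0) x = 1 := by
  cases k with
  | zero => simp only [Function.iterate_zero, id_eq, if_pos hx]
  | succ k => rw [Function.iterate_succ_apply', hT, if_pos hx]

/-- On the first plate (`p x`) the limit voltage equals `1`. [folklore] -/
theorem iSup_iterate_eq_one
    (hT : ∀ f x, T f x = if p x then 1 else if q x then 0 else (∑ y ∈ N x, f y) / ((N x).card : ℝ))
    {x : V} (hx : p x) : (⨆ k, (T^[k] fun z => if p z then (1 : ℝ) else 0) x) = 1 := by
  simp only [iterate_eq_one hT hx, ciSup_const]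

/-- On the second plate (`q x`, off the first) every iterate equals `0`. [folklore] -/
theorem iterate_eq_zero
    (hT : ∀ f x, T f x = if p x then 1 else if q x then 0 else (∑ y ∈ N x, f y) / ((N x).card : ℝ))
    {x : V} (hpx : ¬ p x) (hqx : q x) (k : ℕ) : (T^[k] fun z => if p z then (1 : ℝ) else 0) x = 0 := by
  cases k with
  | zero => simp only [Function.iterate_zero, id_eq, if_neg hpx]
  | succ k => rw [Function.iterate_succ_apply', hT, if_neg hpx, if_pos hqx]

/-- On the second plate (`q x`, off the first) the limit voltage equals `0`. [folklore] -/
theorem iSup_iterate_eq_zero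
    (hT : ∀ f x, T f x = if p x then 1 else if q x then 0 else (∑ y ∈ N x, f y) / ((N x).card : ℝ))
    {x : V} (hpx : ¬ p x) (hqx : q x) : (⨆ k, (T^[k] fun z => if p z then (1 : ℝ) else 0) x) = 0 := by
  simp only [iterate_eq_zero hT hpx hqx, ciSup_const]

/-- Off the plates the limit voltage is the mean of its values over `N x` (finite sums commute with the
monotone limit): the fixed-point equation `v = T v`. [folklore] -/
theorem iSup_iterate_eq_avg
    (hT : ∀ f x, T f x = if p x then 1 else if q x then 0 else (∑ y ∈ N x, f y) / ((N x).card : ℝ))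
    {x : V} (hpx : ¬ p x) (hqx : ¬ q x) :
    (⨆ k, (T^[k] fun z => if p z then (1 : ℝ) else 0) x) =
      (∑ y ∈ N x, ⨆ k, (T^[k] fun z => if p z then (1 : ℝ) else 0) y) / ((N x).card : ℝ) := by
  have h1 : Tendsto (fun k => (T^[k + 1] fun z => if p z then (1 : ℝ) else 0) x) atTop
      (𝓝 (⨆ k, (T^[k] fun z => if p z then (1 : ℝ) else 0) x)) :=
    (tendsto_iterate hT x).comp (tendsto_add_atTop_nat 1)
  have h2 : Tendsto (fun k => (T^[k + 1] fun z => if p z then (1 : ℝ) else 0) x) atTop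
      (𝓝 ((∑ y ∈ N x, ⨆ k, (T^[k] fun z => if p z then (1 : ℝ) else 0) y) / ((N x).card : ℝ))) := by
    have : (fun k => (T^[k + 1] fun z => if p z then (1 : ℝ) else 0) x) =
        fun k => (∑ y ∈ N x, (T^[k] fun z => if p z then (1 : ℝ) else 0) y) / ((N x).card : ℝ) := by
      funext k
      rw [Function.iterate_succ_apply', hT, if_neg hpx, if_neg hqx]
    rw [this]
    exact (tendsto_finsetSum _ fun y _ => tendsto_iterate hT y).div_const _
  exact tendsto_nhds_unique h1 h2

/-- Off the plates the limit voltage is harmonic for the neighbourhoods `N x`: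
`∑_{y ∈ N x} (v y - v x) = 0`. [folklore] -/
theorem sum_sub_iSup_iterate_eq_zero
    (hT : ∀ f x, T f x = if p x then 1 else if q x then 0 else (∑ y ∈ N x, f y) / ((N x).card : ℝ))
    {x : V} (hpx : ¬ p x) (hqx : ¬ q x) :
    ∑ y ∈ N x, ((⨆ k, (T^[k] fun z => if p z then (1 : ℝ) else 0) y) -
      ⨆ k, (T^[k] fun z => if p z then (1 : ℝ) else 0) x) = 0 := by
  rw [Finset.sum_sub_distrib, Finset.sum_const, nsmul_eq_mul]
  rcases eq_or_ne ((N x).card : ℝ) 0 with hc | hc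
  · have h0 : N x = ∅ := Finset.card_eq_zero.mp (by exact_mod_cast hc)
    simp [h0]
  · rw [iSup_iterate_eq_avg hT hpx hqx, mul_div_cancel₀ _ hc, sub_self]

end Abstract

/-! ### The lattice part: heights, measurability, groundedness -/

/-- A lattice neighbour is at most one level higher. [folklore] -/
theorem apply_zero_le_of_adj {x y : Site 3} (h : (zdGraph 3).Adj x y) : y 0 ≤ x 0 + 1 := by
  obtain ⟨i, h | h⟩ := (zdGraph_adj_iff x y).1 h
  · have h0 := congr_fun h 0
    simp only [Pi.add_apply, Pi.single_apply] at h0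
    split_ifs at h0 <;> omega
  · have h0 := congr_fun h 0
    simp only [Pi.add_apply, Pi.single_apply] at h0
    split_ifs at h0 <;> omega

/-- Measurability of the iterates in the configuration: `ω ↦ (T_ω^[k] 1_{x₀ ≥ B}) x` is measurable for
the product σ-algebra (finite sums of indicator-weighted measurable functions, induction on `k`).
[folklore] -/
theorem measurable_iterate (A B : ℤ) {T : BondConfig (Site 3) → (Site 3 → ℝ) → Site 3 → ℝ}
    (hT : ∀ ω f x, T ω f x = if B ≤ x 0 then 1 else if x 0 ≤ -A then 0 else
      (∑ y ∈ ((zdGraph 3).neighborFinset x).filter (fun y => s(x, y) ∈ ω), f y) /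
        ((((zdGraph 3).neighborFinset x).filter (fun y => s(x, y) ∈ ω)).card : ℝ))
    (k : ℕ) (x : Site 3) :
    Measurable fun ω => ((T ω)^[k] fun z => if B ≤ z 0 then (1 : ℝ) else 0) x := by
  induction k generalizing x with
  | zero =>
    simp only [Function.iterate_zero, id_eq]
    exact measurable_const
  | succ k ih =>
    simp only [Function.iterate_succ_apply', hT]
    by_cases h1 : B ≤ x 0
    · simp only [if_pos h1]
      exact measurable_const
    · simp only [if_neg h1]
      by_cases h2 : x 0 ≤ -A
      · simp only [if_pos h2]
        exact measurable_const
      · simp only [if_neg h2]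
        refine Measurable.div ?_ ?_
        · have : (fun ω : BondConfig (Site 3) =>
              ∑ y ∈ ((zdGraph 3).neighborFinset x).filter (fun y => s(x, y) ∈ ω),
                ((T ω)^[k] fun z => if B ≤ z 0 then (1 : ℝ) else 0) y) =
              fun ω => ∑ y ∈ (zdGraph 3).neighborFinset x,
                if s(x, y) ∈ ω then ((T ω)^[k] fun z => if B ≤ z 0 then (1 : ℝ) else 0) y else 0 := by
            funext ω
            rw [Finset.sum_filter]
          rw [this]
          refine Finset.measurable_sum _ fun y _ => ?_
          exact Measurable.ite (measurableSet_mem (s(x, y) : Sym2 (Site 3))) (ih y) measurable_const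
        · have : (fun ω : BondConfig (Site 3) =>
              ((((zdGraph 3).neighborFinset x).filter (fun y => s(x, y) ∈ ω)).card : ℝ)) =
              fun ω => ∑ y ∈ (zdGraph 3).neighborFinset x, if s(x, y) ∈ ω then (1 : ℝ) else 0 := by
            funext ω
            rw [Finset.card_filter, Nat.cast_sum]
            refine Finset.sum_congr rfl fun y _ => ?_
            split_ifs <;> simp
          rw [this]
          refine Finset.measurable_sum _ fun y _ => ?_
          exact Measurable.ite (measurableSet_mem (s(x, y) : Sym2 (Site 3))) measurable_const
            measurable_const

/-- Groundedness of the iterates: if `(T^[k] 1_{x₀ ≥ B}) x ≠ 0` at a vertex of height `x₀ ≤ B`, then `x`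
is joined to the plane `{x₀ = B}` by an open path inside `{x₀ > -A}` (of length `≤ k`). [folklore] -/
theorem iterate_grounded (A B : ℤ) (hAB : -A < B) (ω : BondConfig (Site 3)) {T : (Site 3 → ℝ) → Site 3 → ℝ}
    (hT : ∀ f x, T f x = if B ≤ x 0 then 1 else if x 0 ≤ -A then 0 else
      (∑ y ∈ ((zdGraph 3).neighborFinset x).filter (fun y => s(x, y) ∈ ω), f y) /
        ((((zdGraph 3).neighborFinset x).filter (fun y => s(x, y) ∈ ω)).card : ℝ))
    (k : ℕ) :
    ∀ x : Site 3, x 0 ≤ B → (T^[k] fun z => if B ≤ z 0 then (1 : ℝ) else 0) x ≠ 0 →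
      ∃ y : Site 3, y 0 = B ∧ ω ∈ openConnIn {z : Site 3 | -A < z 0} x y := by
  -- an endpoint on the plane is joined to itself
  have hself : ∀ x : Site 3, x 0 = B → ω ∈ openConnIn {z : Site 3 | -A < z 0} x x := fun x hx =>
    ⟨by simp only [Set.mem_setOf_eq]; omega, by simp only [Set.mem_setOf_eq]; omega,
      SimpleGraph.Reachable.refl _⟩
  induction k with
  | zero =>
    intro x hxB hne
    simp only [Function.iterate_zero, id_eq] at hne
    have hx : B ≤ x 0 := by
      by_contra h
      exact hne (if_neg h)
    exact ⟨x, le_antisymm hxB hx, hself x (le_antisymm hxB hx)⟩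
  | succ k ih =>
    intro x hxB hne
    rw [Function.iterate_succ_apply', hT] at hne
    by_cases hx : B ≤ x 0
    · exact ⟨x, le_antisymm hxB hx, hself x (le_antisymm hxB hx)⟩
    · rw [if_neg hx] at hne
      by_cases hx' : x 0 ≤ -A
      · exact absurd (if_pos hx') hne
      · rw [if_neg hx'] at hne
        have hsum : ∑ y ∈ ((zdGraph 3).neighborFinset x).filter (fun y => s(x, y) ∈ ω),
            (T^[k] fun z => if B ≤ z 0 then (1 : ℝ) else 0) y ≠ 0 := fun h =>
          hne (by rw [h, zero_div])
        obtain ⟨y, hy, hy0⟩ := Finset.exists_ne_zero_of_sum_ne_zero hsum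
        rw [Finset.mem_filter, SimpleGraph.mem_neighborFinset] at hy
        obtain ⟨hadj, hopen⟩ := hy
        have hy1 : y 0 ≤ x 0 + 1 := apply_zero_le_of_adj hadj
        have hyB : y 0 ≤ B := by omega
        obtain ⟨w, hw, hyw⟩ := ih y hyB hy0
        obtain ⟨hyS, hwS, hreach⟩ := hyw
        have hxS : x ∈ {z : Site 3 | -A < z 0} := by
          simp only [Set.mem_setOf_eq]; omega
        have hadj' : ((openGraph ω).induce {z : Site 3 | -A < z 0}).Adj ⟨x, hxS⟩ ⟨y, hyS⟩ := by
          simp only [SimpleGraph.comap_adj, Function.Embedding.coe_subtype, openGraph_adj]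
          exact ⟨hopen, hadj.ne⟩
        exact ⟨w, hw, hxS, hwS, hadj'.reachable.trans hreach⟩

end SlabVoltage

open SlabVoltage in
/-- **`MinimalVoltage`** (item stmt-CriticalPhenomena-7774 of route `PercGamblersRuin`, exact signature):
for all `a < b`, `n > 0` there is `v : Ω → ℤ³ → ℝ`, a slab voltage for every `ω` (values in `[0, 1]`,
`= 1` on `{x₀ ≥ bn}`, `= 0` on `{x₀ ≤ -an}`, harmonic for the open lattice edges at `-an < x₀ < bn`), with
`ω ↦ v(ω, 0)` measurable, and grounded (`v(ω, 0) ≠ 0 ⟹ 0 ↔ {x₀ = bn}` inside `{x₀ > -an}`). The witness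
is the minimal voltage `v = ⨆ k, T_ω^[k] 1_{x₀ ≥ bn}`.
[cite: LyonsPeres2016, §2.1] -/
theorem MinimalVoltage_proof :
    Summit.CriticalPhenomena.PercolationContinuityZ3.Theses.PercGamblersRuin.MinimalVoltage := by
  unfold Theses.PercGamblersRuin.MinimalVoltage
  intro a b n hab hn
  -- the plates: floor depth `A = a n`, ceiling height `B = b n`, `-A < B`, `0 ≤ B`
  have hbn : 0 < b * n := Nat.mul_pos (lt_of_le_of_lt (Nat.zero_le a) hab) hn
  have hAB : -((a * n : ℕ) : ℤ) < ((b * n : ℕ) : ℤ) := by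
    have h1 : (0 : ℤ) ≤ ((a * n : ℕ) : ℤ) := Int.natCast_nonneg _
    have h2 : (0 : ℤ) < ((b * n : ℕ) : ℤ) := by exact_mod_cast hbn
    linarith
  have hB0 : (0 : Site 3) 0 ≤ ((b * n : ℕ) : ℤ) := by
    simp only [Pi.zero_apply]
    exact Int.natCast_nonneg _
  set A : ℤ := ((a * n : ℕ) : ℤ)
  set B : ℤ := ((b * n : ℕ) : ℤ)
  -- the averaging operator of the configuration `ω`
  set T : BondConfig (Site 3) → (Site 3 → ℝ) → Site 3 → ℝ := fun ω f x =>
    if B ≤ x 0 then 1 else if x 0 ≤ -A then 0 else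
      (∑ y ∈ ((zdGraph 3).neighborFinset x).filter (fun y => s(x, y) ∈ ω), f y) /
        ((((zdGraph 3).neighborFinset x).filter (fun y => s(x, y) ∈ ω)).card : ℝ)
  have hT : ∀ ω f x, T ω f x = if B ≤ x 0 then 1 else if x 0 ≤ -A then 0 else
      (∑ y ∈ ((zdGraph 3).neighborFinset x).filter (fun y => s(x, y) ∈ ω), f y) /
        ((((zdGraph 3).neighborFinset x).filter (fun y => s(x, y) ∈ ω)).card : ℝ) := fun ω f x => rfl
  refine ⟨fun ω x => ⨆ k, ((T ω)^[k] fun z => if B ≤ z 0 then (1 : ℝ) else 0) x, ?_, ?_, ?_, ?_, ?_, ?_⟩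
  · -- measurability of `ω ↦ v ω 0`
    exact Measurable.iSup fun k => measurable_iterate A B hT k 0
  · -- values in `[0, 1]`
    intro ω x
    exact iSup_iterate_mem_Icc (p := fun z : Site 3 => B ≤ z 0) (q := fun z : Site 3 => z 0 ≤ -A) (hT ω) x
  · -- ceiling
    intro ω x hx
    exact iSup_iterate_eq_one (p := fun z : Site 3 => B ≤ z 0) (q := fun z : Site 3 => z 0 ≤ -A) (hT ω) hx
  · -- floor
    intro ω x hx
    have hpx : ¬ B ≤ x 0 := by omega
    exact iSup_iterate_eq_zero (p := fun z : Site 3 => B ≤ z 0) (q := fun z : Site 3 => z 0 ≤ -A) (hT ω)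
      hpx hx
  · -- harmonic at interior vertices
    intro ω x hlo hhi
    have hpx : ¬ B ≤ x 0 := by omega
    have hqx : ¬ x 0 ≤ -A := by omega
    exact sum_sub_iSup_iterate_eq_zero (p := fun z : Site 3 => B ≤ z 0) (q := fun z : Site 3 => z 0 ≤ -A)
      (hT ω) hpx hqx
  · -- grounded
    intro ω h0
    have hbdd : BddAbove (Set.range fun k => ((T ω)^[k] fun z => if B ≤ z 0 then (1 : ℝ) else 0) 0) :=
      ⟨1, by
        rintro _ ⟨k, rfl⟩
        exact (iterate_mem_Icc (p := fun z : Site 3 => B ≤ z 0) (q := fun z : Site 3 => z 0 ≤ -A)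
          (hT ω) k 0).2⟩
    have hk : ∃ k, ((T ω)^[k] fun z => if B ≤ z 0 then (1 : ℝ) else 0) 0 ≠ 0 := by
      by_contra hall
      simp only [not_exists, ne_eq, not_not] at hall
      exact h0 (by simp only [hall, ciSup_const])
    obtain ⟨k, hk⟩ := hk
    exact iterate_grounded A B hAB ω (hT ω) k 0 hB0 hk

end Summit.CriticalPhenomena.PercolationContinuityZ3.Theorems

end
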